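import Mathlib
import HarnessLib
import Summits.ABC.ABC.Theses.CongruentialReceptacle
import Summits.ABC.ABC.Theorems.CongruentialReceptacleCompactBalanceTransferSplit
import Summits.ABC.ABC.Theorems.CongruentialReceptacleCompactBalanceTransferPowerDeep

/-! Strategist s1 preview of the D1 split children (exact statements of `children-D1.json`) closed BY NAME
by the landed glue `Summit.ABC.ABC.Theorems.compactBalanceTransfer_of_subs` (p125050). -/

set_option linter.dupNamespace false

namespace Summit.ABC.ABC.Theses.CongruentialReceptacle

def BalancedToFreySzpiroPreview : Prop :=
  (∀ κ : ℝ, 0 < κ → ∀ ε : ℝ, 0 < ε → ∃ C : ℝ, ∀ a b c : ℕ, Literature.NumberTheory.DiophantineGeometry.IsABCTriple a b c → κ * (c : ℝ) ≤ (a : ℝ) → κ * (c : ℝ) ≤ (b : ℝ) → (c : ℝ) < C * ((Literature.NumberTheory.DiophantineGeometry.rad a b c : ℕ) : ℝ) ^ (1 + ε)) → (∀ ε : ℝ, 0 < ε → ∃ C : ℝ, ∀ a b c : ℕ, Literature.NumberTheory.DiophantineGeometry.IsABCTriple a b c → ((a * b * c : ℕ) : ℝ) ^ 2 ≤ C * ((Literature.NumberTheory.DiophantineGeometry.rad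 a b c : ℕ) : ℝ) ^ (6 + ε))

def FreySzpiroToABCPreview : Prop :=
  (∀ ε : ℝ, 0 < ε → ∃ C : ℝ, ∀ a b c : ℕ, Literature.NumberTheory.DiophantineGeometry.IsABCTriple a b c → ((a * b * c : ℕ) : ℝ) ^ 2 ≤ C * ((Literature.NumberTheory.DiophantineGeometry.rad a b c : ℕ) : ℝ) ^ (6 + ε)) → ABC

/-- The split glue, by name. -/
example : BalancedToFreySzpiroPreview → FreySzpiroToABCPreview → CompactBalanceTransfer :=
  Summit.ABC.ABC.Theorems.compactBalanceTransfer_of_subs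

/-- Exactness, by name. -/
example : CompactBalanceTransfer ↔ (BalancedToFreySzpiroPreview ∧ FreySzpiroToABCPreview) :=
  Summit.ABC.ABC.Theorems.compactBalanceTransfer_iff_subs

/-- Child 2 is equivalent to the live skeleton's second stub (power-deep form), by name. -/
example : FreySzpiroToABCPreview ↔
    ((∀ ε : ℝ, 0 < ε → ∃ C : ℝ, ∀ a b c : ℕ, Literature.NumberTheory.DiophantineGeometry.IsABCTriple a b c →
        ((a * b * c : ℕ) : ℝ) ^ 2 ≤ C * ((Literature.NumberTheory.DiophantineGeometry.rad a b c : ℕ) : ℝ) ^ (6 + ε)) →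
      ∀ δ : ℝ, 0 < δ → ∀ ε : ℝ, 0 < ε → ∃ C : ℝ, ∀ a b c : ℕ, Literature.NumberTheory.DiophantineGeometry.IsABCTriple a b c →
        Real.log ((min a b : ℕ) : ℝ) ≤ (1 - δ) * Real.log (c : ℝ) →
          (c : ℝ) < C * ((Literature.NumberTheory.DiophantineGeometry.rad a b c : ℕ) : ℝ) ^ (1 + ε)) :=
  Summit.ABC.ABC.Theorems.CompactBalanceTransfer.PowerDeep.freySzpiroToABC_iff_powerDeep

/-- Sanity for census T10 (the bounded-j family E′ with j = 1728·a/c): its invariants satisfy the Weierstrass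
identity c₄³ − c₆² = 1728·Δ with c₄ = −36ab, c₆ = 216ab², Δ = −27a²b³(a+b). -/
example (a b : ℤ) : (-36 * a * b) ^ 3 - (216 * a * b ^ 2) ^ 2 = 1728 * (-27 * a ^ 2 * b ^ 3 * (a + b)) := by ring

/-- Sanity for census T10 (the optimal bounded-j family E″, J(λ) = 27λ(9λ−8)³/(λ−1)): J − 1728 is a perfect
square over the pole, 27λ(9λ−8)³ − 1728(λ−1) = 27(27λ² − 36λ + 8)², so J is an orbifold-unramified Belyi map of
degree 4 over ℚ with J(0) = 0 (finite monodromy at the deep cusp) and poles exactly at λ = 1 (order 1), ∞ (order 3). -/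
example (x : ℚ) : 27 * x * (9 * x - 8) ^ 3 - 1728 * (x - 1) = 27 * (27 * x ^ 2 - 36 * x + 8) ^ 2 := by ring

end Summit.ABC.ABC.Theses.CongruentialReceptacle
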